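import Summits.QuantumAdvantage.AdviceFreeQNC0.RingSymmetry
import Summits.QuantumAdvantage.AdviceFreeQNC0.DualDistanceCount
import HarnessLib

/-!
# Cell qa-qnc0 (rung F-Q1, route RingFrame, crux α `RingToElim`): EXACT-HIT hardness is below α, the
# exact-hit sum law, and the DUAL-WORD SUPPORT FENCE (planner qa-qnc0-p2 ROUND-8, asks R8-a)

Planner qa-qnc0-p2 gen 8 (`HOME/qa-qnc0-p2/ROUND-8.md` §2–§3, `line/Sketch8.lean`, ns `QaQnc0.Sketch8p2`;
statements VERBATIM below: `WalkHardPolylog`, `exactHit`, `ExactHitHard`, `ExactHitOfWalkHard`,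
`ExactHitSum`, `WalkDualSupport`).  All three supports PROVED:

* `exactHitOfWalkHard : ExactHitOfWalkHard` — `exactHit ch y u = WIN_ch ∧ WIN_{ch+1}` is below `WIN_ch`
  pointwise, so α in walk form (every charge, polylog degree) gives exact-hit hardness with the same `θ`.
* `exactHitSum : ExactHitSum` — by the three-charge law (`threeChargeLaw`: at every input an even number
  of the three charges win) at most ONE adjacent pair of charges hits at each input, so
  `Σ_{c'<3} #exactHit(ch + c') ≤ 2ⁿ` (the charge lottery is worth `1/3` for hitting).
* `walkDualSupport : WalkDualSupport` — a nonzero Boolean `ψ` orthogonal mod 2 to the WIN pattern of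
  EVERY degree-`≤ D` strategy has `|supp ψ| ≥ 2^{D+1}`: the ONE-CUT strategies (`oneCut g p`: selector
  `p` at the cut `g`, nothing elsewhere) win exactly on `p ∧ ℓ_g` (`ringWinU_oneCut`), so `supp ψ ∩ {ℓ_g}`
  annihilates `lowDeg D` for `g = 0, 1`; the literals `ℓ_0`, `ℓ_1` have no common zero
  (`1 + u₀ ≢ 0 (mod 3)`), so one of the two sets is nonempty and the tree's dual-distance count
  (`two_pow_succ_le_card_of_sum_lowDeg_eq_zero`) gives `2^{D+1}` points inside `supp ψ`.
  Consequence (ROUND-8 §3): every covering-LP / odd-dual-word certificate for α is worth at most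
  `#FAIL ≥ 2^{n−D−1}`.

WHAT THIS IS NOT: `ExactHitHard` is WEAKER than α and carries no circuit separation; nothing here proves
α or MULT₁; separation NOT moved.
-/

noncomputable section

namespace Summit.QuantumAdvantage.AdviceFreeQNC0

open Finset
open Literature.Computability.MetaComplexity Literature.Computability.MetaComplexity.Smolensky

/-! ### Sketch8 (qn-p2 gen 8) statements, verbatim -/

/-- α in WALK form at polylog degree, every charge (the hypothesis shape of
`WalkTransport.ringHard_two_of_walkHard`, which is stated at charge `n + 2`).  (Sketch8p2, verbatim.) -/
def WalkHardPolylog : Prop :=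
  ∃ θ : ℝ, θ < 1 ∧ ∀ C : ℕ, ∃ n₀ : ℕ, ∀ n ≥ n₀, ∀ (ch : ℕ) (y : Fin (n + 1) → (Fin n → Bool) → Bool),
    (∀ g, HasDeg (y g) ((Nat.log 2 n) ^ C)) →
      ((univ.filter fun u : Fin n → Bool => ringWinU ch y u = true).card : ℝ) ≤ θ * (2 : ℝ) ^ n

/-- EXACT HIT: `y` wins at charges `ch` and `ch + 1` simultaneously at `u`
(⟺ `f_y(u)` equals one prescribed unit of 𝔽₄).  (Sketch8p2, verbatim.) -/
def exactHit {n : ℕ} (ch : ℕ) (y : Fin (n + 1) → (Fin n → Bool) → Bool) (u : Fin n → Bool) : Bool :=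
  ringWinU ch y u && ringWinU (ch + 1) y u

/-- **Exact-hit hardness** at polylog degree: no strategy makes `f_y` a.e. constant.  A consequence of α;
instrument (ROUND-8 §2), not a rung.  (Sketch8p2, verbatim.) -/
def ExactHitHard : Prop :=
  ∃ θ : ℝ, θ < 1 ∧ ∀ C : ℕ, ∃ n₀ : ℕ, ∀ n ≥ n₀, ∀ (ch : ℕ) (y : Fin (n + 1) → (Fin n → Bool) → Bool),
    (∀ g, HasDeg (y g) ((Nat.log 2 n) ^ C)) →
      ((univ.filter fun u : Fin n → Bool => exactHit ch y u = true).card : ℝ) ≤ θ * (2 : ℝ) ^ n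

/-- support (S, `filter_subset`): α in walk form ⟹ exact-hit hardness.  (Sketch8p2, verbatim.) -/
def ExactHitOfWalkHard : Prop := WalkHardPolylog → ExactHitHard

/-- **Exact-hit sum law** (support, S, from `RingSymmetry.threeChargeLaw`): for EVERY strategy the three
adjacent charge pairs hit on pairwise disjoint input sets, so `Σ_{c'<3} #exactHit(ch + c') ≤ 2ⁿ`
(the charge lottery is worth `1/3` for hitting, `2/3` for avoiding).  (Sketch8p2, verbatim.) -/
def ExactHitSum : Prop :=
  ∀ (n ch : ℕ) (y : Fin (n + 1) → (Fin n → Bool) → Bool),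
    ∑ c' ∈ range 3, (univ.filter fun u : Fin n → Bool => exactHit (ch + c') y u = true).card ≤ 2 ^ n

/-- **Dual-word support fence** (support, S): a nonzero Boolean `ψ` that is orthogonal mod 2 to the WIN
pattern of every degree-`≤ D` strategy at charge `ch` has `|supp ψ| ≥ 2^{D+1}`.  Consequence:
covering-LP certificates prove at most `#FAIL ≥ 2^{n−D−1}`.  (Sketch8p2, verbatim.) -/
def WalkDualSupport : Prop :=
  ∀ (n D ch : ℕ) (ψ : (Fin n → Bool) → Bool), 1 ≤ n → (∃ u, ψ u = true) →
    (∀ y : Fin (n + 1) → (Fin n → Bool) → Bool, (∀ g, HasDeg (y g) D) →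
      (univ.filter fun u : Fin n → Bool => ψ u = true ∧ ringWinU ch y u = true).card % 2 = 0) →
    2 ^ (D + 1) ≤ (univ.filter fun u : Fin n → Bool => ψ u = true).card

/-! ### Exact-hit hardness is below α -/

/-- **`ExactHitOfWalkHard` — PROVED**: `exactHit ≤ WIN_ch` pointwise. -/
theorem exactHitOfWalkHard : ExactHitOfWalkHard := by
  rintro ⟨θ, hθ, h⟩
  refine ⟨θ, hθ, fun C => ?_⟩
  obtain ⟨n₀, hn₀⟩ := h C
  refine ⟨n₀, fun n hn ch y hdeg => le_trans ?_ (hn₀ n hn ch y hdeg)⟩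
  exact_mod_cast card_le_card (fun u hu => by
    rw [mem_filter] at hu ⊢
    exact ⟨hu.1, (Bool.and_eq_true_iff.1 hu.2).1⟩)

/-! ### The exact-hit sum law -/

namespace ExactHit

variable {n : ℕ}

/-- The win pattern depends on the charge only mod `3` (here: `ch + 3`). -/
theorem ringWinU_add_three (ch : ℕ) (y : Fin (n + 1) → (Fin n → Bool) → Bool) (u : Fin n → Bool) :
    ringWinU (ch + 3) y u = ringWinU ch y u := by
  unfold ringWinU
  have hs : (univ.filter fun g : Fin (n + 1) =>
        y g u = true ∧ (ch + 3 + g.val + walkExp u g.val) % 3 ≠ 0) =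
      univ.filter fun g : Fin (n + 1) => y g u = true ∧ (ch + g.val + walkExp u g.val) % 3 ≠ 0 := by
    refine filter_congr fun g _ => ?_
    have : (ch + 3 + g.val + walkExp u g.val) % 3 = (ch + g.val + walkExp u g.val) % 3 := by omega
    rw [this]
  rw [hs]

/-- At every input at most one adjacent pair of charges hits (three-charge law). -/
theorem card_filter_exactHit_le_one (ch : ℕ) (y : Fin (n + 1) → (Fin n → Bool) → Bool) (u : Fin n → Bool) :
    ((range 3).filter fun c' => exactHit (ch + c') y u = true).card ≤ 1 := by
  have hlaw := threeChargeLaw n ch y u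
  rw [Finset.card_filter, Finset.sum_range_succ, Finset.sum_range_succ, Finset.sum_range_succ,
    Finset.sum_range_zero] at hlaw ⊢
  unfold exactHit
  rw [show ch + 2 + 1 = ch + 3 by ring, ringWinU_add_three, show ch + 1 + 1 = ch + 2 by ring]
  simp only [Nat.add_zero] at hlaw ⊢
  revert hlaw
  cases ringWinU ch y u <;> cases ringWinU (ch + 1) y u <;> cases ringWinU (ch + 2) y u <;> simp

end ExactHit

open ExactHit

/-- **`ExactHitSum` — PROVED**: `Σ_{c'<3} #exactHit(ch + c') ≤ 2ⁿ` for every strategy. -/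
theorem exactHitSum : ExactHitSum := by
  intro n ch y
  calc ∑ c' ∈ range 3, (univ.filter fun u : Fin n → Bool => exactHit (ch + c') y u = true).card
      = ∑ c' ∈ range 3, ∑ u : Fin n → Bool, (if exactHit (ch + c') y u = true then 1 else 0) := by
        refine Finset.sum_congr rfl fun c' _ => ?_
        rw [Finset.card_filter]
    _ = ∑ u : Fin n → Bool, ∑ c' ∈ range 3, (if exactHit (ch + c') y u = true then 1 else 0) :=
        Finset.sum_comm
    _ = ∑ u : Fin n → Bool, ((range 3).filter fun c' => exactHit (ch + c') y u = true).card := by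
        refine Finset.sum_congr rfl fun u _ => ?_
        rw [Finset.card_filter]
    _ ≤ ∑ _u : Fin n → Bool, 1 := Finset.sum_le_sum fun u _ => card_filter_exactHit_le_one ch y u
    _ = 2 ^ n := by
        rw [Finset.sum_const, card_univ, Fintype.card_fun, Fintype.card_bool, Fintype.card_fin,
          smul_eq_mul, mul_one]

/-! ### The dual-word support fence -/

namespace ExactHit

variable {n : ℕ}

/-- The literal of the cut `g`: `ℓ_g(u) = [ch + g + |u| + |u_{<g}| ≢ 0 (mod 3)]`. -/
def lit (ch g : ℕ) (u : Fin n → Bool) : Bool := decide ((ch + g + walkExp u g) % 3 ≠ 0)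

/-- The ONE-CUT strategy: selector `p` at the cut `g`, nothing elsewhere. -/
def oneCut (g : Fin (n + 1)) (p : (Fin n → Bool) → Bool) : Fin (n + 1) → (Fin n → Bool) → Bool :=
  fun g' => if g' = g then p else fun _ => false

/-- A one-cut strategy wins exactly on `p ∧ ℓ_g`. -/
theorem ringWinU_oneCut (ch : ℕ) (g : Fin (n + 1)) (p : (Fin n → Bool) → Bool) (u : Fin n → Bool) :
    ringWinU ch (oneCut g p) u = (p u && lit ch g.val u) := by
  unfold ringWinU oneCut lit
  by_cases hp : p u = true ∧ (ch + g.val + walkExp u g.val) % 3 ≠ 0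
  · have hset : (univ.filter fun g' : Fin (n + 1) =>
        (if g' = g then p else fun _ => false) u = true ∧ (ch + g'.val + walkExp u g'.val) % 3 ≠ 0) = {g} := by
      ext g'
      simp only [mem_filter, mem_univ, true_and, mem_singleton]
      constructor
      · rintro ⟨h1, _⟩
        by_contra hne
        rw [if_neg hne] at h1
        exact Bool.false_ne_true h1
      · rintro rfl
        rw [if_pos rfl]
        exact hp
    rw [hset, card_singleton]
    obtain ⟨h1, h2⟩ := hp
    rw [h1]
    simp [h2]
  · have hset : (univ.filter fun g' : Fin (n + 1) =>
        (if g' = g then p else fun _ => false) u = true ∧ (ch + g'.val + walkExp u g'.val) % 3 ≠ 0) = ∅ := by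
      ext g'
      simp only [mem_filter, mem_univ, true_and, Finset.notMem_empty, iff_false]
      rintro ⟨h1, h2⟩
      by_cases hne : g' = g
      · subst hne
        rw [if_pos rfl] at h1
        exact hp ⟨h1, h2⟩
      · rw [if_neg hne] at h1
        exact Bool.false_ne_true h1
    rw [hset, card_empty]
    rw [not_and_or] at hp
    rcases hp with h1 | h2
    · rw [Bool.not_eq_true] at h1; rw [h1]; simp
    · cases p u <;> simp [h2]

/-- The one-cut strategy has the degree of its selector. -/
theorem hasDeg_oneCut {D : ℕ} (g : Fin (n + 1)) {p : (Fin n → Bool) → Bool} (hp : HasDeg p D)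
    (g' : Fin (n + 1)) : HasDeg (oneCut g p g') D := by
  unfold oneCut
  by_cases h : g' = g
  · rw [if_pos h]; exact hp
  · rw [if_neg h]
    unfold HasDeg
    have : (fun x : Fin n → Bool => if false = true then (1 : ZMod 2) else 0) = 0 := by
      funext x; simp
    rw [this]
    exact Submodule.zero_mem _

/-- `|u_{<1}| ≤ 1`. -/
theorem wtPrefix_one_le (u : Fin n → Bool) : wtPrefix u 1 ≤ 1 := by
  unfold wtPrefix
  refine le_trans (card_le_card (fun i hi => ?_ : (univ.filter fun i : Fin n => i.val < 1 ∧ u i = true) ⊆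
    univ.filter fun i : Fin n => i.val < 1)) ?_
  · rw [mem_filter] at hi ⊢; exact ⟨hi.1, hi.2.1⟩
  · rw [Finset.card_le_one]
    intro a ha b hb
    rw [mem_filter] at ha hb
    exact Fin.ext (by omega)

/-- The literals of the cuts `0` and `1` have no common zero. -/
theorem lit_zero_or_one (ch : ℕ) (u : Fin n → Bool) : lit ch 0 u = true ∨ lit ch 1 u = true := by
  unfold lit walkExp
  have h0 : wtPrefix u 0 = 0 := by unfold wtPrefix; simp
  have h1 := wtPrefix_one_le u
  simp only [decide_eq_true_eq, h0, add_zero]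
  omega

/-- Orthogonality to all one-cut wins at the cut `g` makes `supp ψ ∩ {ℓ_g}` annihilate `lowDeg D`. -/
theorem sum_support_lit_eq_zero {D ch : ℕ} (ψ : (Fin n → Bool) → Bool) (g : Fin (n + 1))
    (horth : ∀ y : Fin (n + 1) → (Fin n → Bool) → Bool, (∀ g', HasDeg (y g') D) →
      (univ.filter fun u : Fin n → Bool => ψ u = true ∧ ringWinU ch y u = true).card % 2 = 0)
    (q : CubeFn (ZMod 2) n) (hq : q ∈ lowDeg (ZMod 2) n D) :
    ∑ u ∈ univ.filter (fun u : Fin n → Bool => ψ u = true ∧ lit ch g.val u = true), q u = 0 := by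
  -- the selector `p = [q = 1]` has degree `≤ D` (its indicator is `q` itself)
  have hind : BlockSplitting.indF2 (fun u : Fin n → Bool => decide (q u = 1)) = q :=
    BlockSplitting.indF2_decide q
  have hp : HasDeg (fun u : Fin n → Bool => decide (q u = 1)) D := by
    show BlockSplitting.indF2 (fun u : Fin n → Bool => decide (q u = 1)) ∈ lowDeg (ZMod 2) n D
    rw [hind]; exact hq
  have h := horth (oneCut g fun u => decide (q u = 1)) (hasDeg_oneCut g hp)
  simp only [ringWinU_oneCut, Bool.and_eq_true] at h
  -- the sum of `q` over the set is the parity of `#{ψ ∧ p ∧ ℓ_g}`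
  have hq01 : ∀ u, q u = if decide (q u = 1) = true then 1 else 0 :=
    fun u => (congrFun hind u).symm
  rw [Finset.sum_congr rfl fun u _ => hq01 u, ← Finset.sum_filter, Finset.filter_filter]
  simp only [sum_const, nsmul_eq_mul, mul_one]
  rw [ZMod.natCast_eq_zero_iff_even, Nat.even_iff]
  have hset : (univ.filter fun u : Fin n → Bool =>
        (ψ u = true ∧ lit ch g.val u = true) ∧ decide (q u = 1) = true) =
      univ.filter fun u : Fin n → Bool =>
        ψ u = true ∧ (decide (q u = 1) = true ∧ lit ch g.val u = true) := by
    ext u; simp only [mem_filter, mem_univ, true_and]; tauto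
  rw [hset]
  exact h

end ExactHit

/-- **`WalkDualSupport` — PROVED** (one-cut strategies + the dual-distance count). -/
theorem walkDualSupport : WalkDualSupport := by
  intro n D ch ψ hn hψ horth
  obtain ⟨u₀, hu₀⟩ := hψ
  -- one of the two sets `supp ψ ∩ {ℓ_0}`, `supp ψ ∩ {ℓ_1}` is nonempty
  have key : ∀ g : Fin (n + 1), (univ.filter fun u : Fin n → Bool => ψ u = true ∧ lit ch g.val u = true).Nonempty →
      2 ^ (D + 1) ≤ (univ.filter fun u : Fin n → Bool => ψ u = true).card := by
    intro g hne
    refine le_trans (two_pow_succ_le_card_of_sum_lowDeg_eq_zero D _ hne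
      (fun q hq => sum_support_lit_eq_zero ψ g horth q hq)) (card_le_card fun u hu => ?_)
    rw [mem_filter] at hu ⊢
    exact ⟨hu.1, hu.2.1⟩
  rcases lit_zero_or_one ch u₀ with h0 | h1
  · exact key ⟨0, by omega⟩ ⟨u₀, by rw [mem_filter]; exact ⟨mem_univ _, hu₀, h0⟩⟩
  · exact key ⟨1, by omega⟩ ⟨u₀, by rw [mem_filter]; exact ⟨mem_univ _, hu₀, h1⟩⟩

end Summit.QuantumAdvantage.AdviceFreeQNC0
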